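import Summits.BirchSwinnertonDyer.BirchSwinnertonDyer.Theorems.PrintCf2DisegniPairTwoTameTransportNeg
import Summits.BirchSwinnertonDyer.BirchSwinnertonDyer.Theorems.PrintCf2DisegniPairTwoMinusSymbolTwistPeriod
import Literature.NumberTheory.EllipticCurves.PAdicLFunctionTameBranchBirchTransformProofs
import Literature.NumberTheory.EllipticCurves.PAdicLFunctionMinusBranchInterpolationProofs
import Literature.NumberTheory.EllipticCurves.PAdicLFunctionMinusDenominatorsProofs
import HarnessLib

/-!
# Road (C) `disegni-pair-two` on crux stmt-BirchSwinnertonDyer-20368 — BIRCH TRANSPORT on the `2`-adic side for the ODD classes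
# (`χ₋₄∘N`, `χ₋₈∘N`): the SIGN BRANCH `L⁻₂(f_V, α_V, ω, T)` of the good curve `V = E^{(d)}` is `c · (1+T)^{−ℓ} ·` (the `ω χ_d`-branch of
# the tame transform of the MINUS (`d > 0`) / PLUS (`d < 0`) measure of the base `E`), with the SAME `c` as in
# `c²·|d|·(Ω⁻_{f_V})² = (Ω^∓_{f_E})²`; the first coefficient and the derivative at the conductor-`8` point transport accordingly

Cell `bsd-print-cf2`, width seat `bsd-line-cf2-p1-w8` g24; the odd-class (`T⁻⁻`) twin of `PrintCf2DisegniPairTwoTameTransport[Neg].lean`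
(memo `Cruxes/SplitBadTwoRankOneOfFacts/PERIOD-CANCELS-w8g24.md` §6–§8, step G5). `--supports stmt-BirchSwinnertonDyer-20368` (helper).
THEOREMS ONLY (no `def`, no named fact, no `sorry`); conditional on every displayed hypothesis (modularity `exists_isNewformOf` is the
displayed named fact of the tree's Birch lemmas). BSD is not proved by any of this; no summit statement is claimed; 20368 is not
closed here.

## What is proved (base `E` globally minimal, good ordinary at `2`; `d ≡ 1 (4)` squarefree, `(d, N_E) = 1`; `V` a globally minimal
model of `E^{(d)}`; `G` = `padicLFunctionTameMinusBranch f_E |d| α_E (ωχ_d) 1` for `d > 0`, `padicLFunctionTameBranch …` for `d < 0`)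

* §0 `coeff_one_eq_of_eq_C_mul_binomialSeries_mul` — `L = C(c)·(1+T)^{s}·G`, `L(0) = 0`, `c ≠ 0` ⇒ `G(0) = 0` and `[T¹]L = c·[T¹]G`;
  `exists_eq_C_mul_of_sign` — a sign `ω(m) = ±1` on the left of a Birch identity is absorbed into the constant (`c ↦ ±c`, same `c²`).
* §1 ★★ `exists_birchConstantMinus_two` (`d > 0`) / `exists_birchConstantMinus_two_neg` (`d < 0`) — ONE `c ∈ ℚˣ` with
  `L⁻₂(f_V, α_V, ω, T) = C(c)·(1+T)^{−ℓ_m}·G` AND `c²·|d|·(Ω⁻_{f_V})² = (Ω⁻_{f_E})²` (resp. `= (Ω⁺_{f_E})²`): the minus-symbol Birch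
  lemma with squared period constants (`exists_ratMinusSymbol_twist_eq_sum_and_sq[_neg…]`), the branch transform identity
  (`padicLFunctionMinusBranch_twist_eq_of_birch_even|odd`, sign `ω(m) = ±1` absorbed), `c ≠ 0` from `Ω^∓_{f_E} > 0`.
* §2 ★★ `coeff_one_padicLFunctionMinusBranch_twist_eq[_neg]` (`χ₋₄`-type object `[T¹]L⁻₂`, under `L⁻₂(0) = 0`):
  `[T¹]L⁻₂(f_V) = c·[T¹]G`, `≠ 0` simultaneously, `v₂ = v₂(c) + v₂`; ★★ `deriv_padicLFunctionMinusBranch_twist_eq[_neg]` and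
  `valuation_deriv_padicLFunctionMinusBranch_twist_eq[_neg]` (`χ₋₈`-type object, the derivative at `T = −2` under vanishing there):
  `D_V = c·u·D_G`, `‖u‖₂ = 1`, hence `D_V ≠ 0 ↔ D_G ≠ 0` and `v₂(D_V) = v₂(c) + v₂(D_G)` — always with the SAME `c` as the period identity.

References: B. Mazur, J. Tate, J. Teitelbaum, Invent. Math. 84 (1986) §I.8, §I.11–I.13 [MazurTateTeitelbaum1986Invent]; K. Matsuno,
J. Number Theory 84 (2000) §2, Lemma 3.3 [Matsuno2000]; V. Pal, Proc. AMS 140 (2012) Thm. 3.2 [Pal2012].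
-/

set_option autoImplicit false
set_option linter.dupNamespace false

noncomputable section

open scoped Classical MatrixGroups ModularForm NumberField NumberTheorySymbols

open CongruenceSubgroup NumberField IsDedekindDomain WeierstrassCurve PowerSeries
  Literature.NumberTheory.EllipticCurves Literature.NumberTheory.EllipticCurves.ModularForms
  Literature.NumberTheory.EllipticCurves.GreenbergVatsal2000 Literature.NumberTheory.GaloisRepresentations
  Literature.NumberTheory.EllipticCurves.PadicEval

namespace Summit.BirchSwinnertonDyer.BirchSwinnertonDyer.Theorems.PrintCf2.DisegniPairTwo

/-! ### §0 Power-series bookkeeping -/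

/-- **First coefficient through a Birch identity at a zero of the constant term**: if `L = C(c)·(1+T)^{s}·G` with `c ≠ 0` and
`L(0) = 0`, then `G(0) = 0` and `[T¹]L = c·[T¹]G` (`[T¹]((1+T)^s G) = G₁ + s·G₀`). [cite: MazurTateTeitelbaum1986Invent, §I.12] -/
theorem coeff_one_eq_of_eq_C_mul_binomialSeries_mul {L G : PowerSeries ℚ_[2]} {c : ℚ_[2]} (hc : c ≠ 0) (s : ℤ_[2])
    (hL : L = PowerSeries.C c * PowerSeries.binomialSeries ℚ_[2] s * G) (h0 : PowerSeries.constantCoeff L = 0) :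
    PowerSeries.constantCoeff G = 0 ∧ PowerSeries.coeff 1 L = c * PowerSeries.coeff 1 G := by
  have h0' : PowerSeries.coeff 0 L = c * PowerSeries.coeff 0 G := by
    rw [hL, coeff_C_mul_binomialSeries_mul, Finset.sum_range_one, Nat.sub_zero, Ring.choose_zero_right, map_one,
      one_mul]
  have hG0 : PowerSeries.coeff 0 G = 0 := by
    rw [PowerSeries.coeff_zero_eq_constantCoeff_apply, h0] at h0'
    rcases mul_eq_zero.mp h0'.symm with h | h
    · exact absurd h hc
    · exact h
  refine ⟨by rw [← PowerSeries.coeff_zero_eq_constantCoeff_apply]; exact hG0, ?_⟩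
  rw [hL, coeff_C_mul_binomialSeries_mul, Finset.sum_range_succ, Finset.sum_range_one, Nat.sub_zero, Nat.sub_self,
    Ring.choose_zero_right, map_one, one_mul, hG0, mul_zero, zero_add]

/-- **Absorbing the sign**: from `C(t)·L = C(c)·R` with `t = ±1` (the Teichmüller representative `ω(m)` at `p = 2`) get
`L = C(c')·R` with `c'² = c²` (`c' = ±c`). [cite: MazurTateTeitelbaum1986Invent, §I.13 (p = 2)] -/
theorem exists_eq_C_mul_of_sign {L R : PowerSeries ℚ_[2]} {t : ℤ_[2]} (ht : t = 1 ∨ t = -1) {c : ℚ}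
    (h : PowerSeries.C (((t : ℚ_[2])) ^ 1) * L = PowerSeries.C (c : ℚ_[2]) * R) :
    ∃ c' : ℚ, c' ^ 2 = c ^ 2 ∧ L = PowerSeries.C (c' : ℚ_[2]) * R := by
  rcases ht with rfl | rfl
  · rw [PadicInt.coe_one, one_pow, map_one, one_mul] at h
    exact ⟨c, rfl, h⟩
  · rw [PadicInt.coe_neg, PadicInt.coe_one, pow_one] at h
    refine ⟨-c, neg_sq c, ?_⟩
    calc L = PowerSeries.C (-1 : ℚ_[2]) * (PowerSeries.C (-1 : ℚ_[2]) * L) := by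
          rw [← mul_assoc, ← map_mul, neg_mul_neg, one_mul, map_one, one_mul]
      _ = PowerSeries.C ((-c : ℚ) : ℚ_[2]) * R := by rw [h, ← mul_assoc, ← map_mul, Rat.cast_neg, neg_one_mul]

section Transport

variable (E : WeierstrassCurve ℚ) [E.IsElliptic] [E.IsGloballyMinimal] {d : ℤ} {V : WeierstrassCurve ℚ}
  [V.IsElliptic] [V.IsGloballyMinimal] [NeZero (E.conductorNorm ℤ)] [NeZero (V.conductorNorm ℤ)] [NeZero d.natAbs]
  {fE : CuspForm (Gamma0 (E.conductorNorm ℤ)) 2} {fV : CuspForm (Gamma0 (V.conductorNorm ℤ)) 2}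

/-- `‖−2‖₂ < 1`. [folklore] -/
private theorem norm_neg_two_lt_one₃ : ‖(-2 : ℚ_[2])‖ < 1 := by
  rw [norm_neg, show (2 : ℚ_[2]) = ((2 : ℕ) : ℚ_[2]) by norm_num, Padic.norm_p]
  norm_num

omit [NeZero (V.conductorNorm ℤ)] in
/-- **Bounded coefficients of the sign branches** `L⁻₂(f_V, α_V, ω^i, T)` of the newform of a good ordinary `V` (Manin–Drinfeld bound
for `μ⁻`, `exists_norm_msdMinusMeasure_le_of_maninDrinfeld`; distribution relation `sum_fiber_msdMinusMeasure_succ_eq_of_coeffField`;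
`norm_coeff_padicLFunctionMinusBranch_le`). [cite: MazurTateTeitelbaum1986Invent, §I.10–I.13] -/
theorem exists_norm_coeff_padicLFunctionMinusBranch_le (hordV : IsOrdinaryAt V 2) {M : ℕ} [NeZero M]
    {g : CuspForm (Gamma0 M) 2} (hg : IsNewformOf V g) (i : ℕ) :
    ∃ B : ℝ, ∀ k : ℕ, ‖PowerSeries.coeff k (padicLFunctionMinusBranch g (unitRoot V 2 : ℚ_[2]) i)‖ ≤ B := by
  obtain ⟨hαeq, hαu, hα0⟩ := unitRoot_coe_spec (W := V) hordV
  obtain ⟨B, hB⟩ := exists_norm_msdMinusMeasure_le_of_maninDrinfeld (p := 2)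
    (exists_nsmul_modularSymbol_mem_periodLattice_of_isNewformOf hg) hαu
  exact ⟨B, fun k ↦ norm_coeff_padicLFunctionMinusBranch_le g _
    (sum_fiber_msdMinusMeasure_succ_eq_of_coeffField hg.1 hg.coeffField_eq_bot (not_dvd_level_of_isNewformOf hg hordV.1)
      (cuspCoeff_eq_frobeniusTrace_of_isNewformOf_holds hg hordV.1) hα0 hαeq) hB i k⟩

/-! ### §1 One Birch constant for both sides, sign branch, `d > 0` -/

/-- ★★ **One Birch constant at `p = 2` for the SIGN branch, `d > 0`.** For a globally minimal base `E/ℚ` good ordinary at `2`,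
`d > 0` squarefree with `d ≡ 1 (mod 4)` and `(d, N_E) = 1`, a globally minimal model `V` of `E^{(d)}` and the newforms `f_E`, `f_V`:
`V` is good ordinary at `2`, and there is ONE `c ∈ ℚˣ` with
(i) `L⁻₂(f_V, α_V, ω, T) = C(c)·(1+T)^{−ℓ_m}·L⁻₂(f_E, m, α_E, ωχ_d, T)` (`m = d`; the `ω`-branch of the `χ_d`-twisted MINUS tame transform of
`f_E`) and (ii) `c²·d·(Ω⁻_{f_V})² = (Ω⁻_{f_E})²`. [cite: MazurTateTeitelbaum1986Invent, §I.8 and §I.11–I.13] [cite: Matsuno2000, §2 (p. 84)] -/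
theorem exists_birchConstantMinus_two (hmod : exists_isNewformOf) (hd : 0 < d) (hd4 : d % 4 = 1) (hsq : Squarefree d)
    (hcop : IsCoprime d (E.conductorNorm ℤ : ℤ)) {C₀ : VariableChange ℚ} (hV : C₀ • E.quadraticTwist (d : ℚ) = V)
    (hfE : IsNewformOf E fE) (hfV : IsNewformOf V fV) (hord : IsOrdinaryAt E 2)
    {χ : MulChar (ZMod d.natAbs) ℤ} (hχ : ∀ a : ZMod d.natAbs, χ a = J((a.val : ℤ) | d.natAbs)) :
    IsOrdinaryAt V 2 ∧ ∃ c : ℚ, c ≠ 0 ∧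
      padicLFunctionMinusBranch fV (unitRoot V 2 : ℚ_[2]) 1 =
        PowerSeries.C (c : ℚ_[2]) * PowerSeries.binomialSeries ℚ_[2] (-frobeniusExponent 2 (d.natAbs : ℤ_[2])) *
          padicLFunctionTameMinusBranch fE d.natAbs (unitRoot E 2 : ℚ_[2])
            ((χ.ringHomComp (Int.castRingHom ℚ)).ringHomComp (Rat.castHom ℚ_[2])) 1 ∧
      (c : ℝ) ^ 2 * (d : ℝ) * minusPeriod fV ^ 2 = minusPeriod fE ^ 2 := by
  have hp : (2 : ℕ).Prime := Nat.prime_two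
  have hpd : ¬ ((2 : ℕ) : ℤ) ∣ d := by omega
  obtain ⟨c, hB, hper⟩ := exists_ratMinusSymbol_twist_eq_sum_and_sq E hmod hd hd4 hsq hcop hV hfE hfV hχ
  obtain ⟨hordV, hαV⟩ := isOrdinaryAt_twist_and_unitRoot_eq E 2 hmod hd4 hsq hcop hV hord hpd
  obtain ⟨hαeq, hαu, -⟩ := unitRoot_coe_spec (W := E) hord
  have hpN : ¬ 2 ∣ E.conductorNorm ℤ := not_dvd_level_of_isNewformOf hfE hord.1
  have hpm : ¬ 2 ∣ d.natAbs := fun h ↦ hpd (Int.natCast_dvd.mpr h)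
  have hmp : d.natAbs.Coprime 2 := Nat.coprime_comm.mp ((Nat.Prime.coprime_iff_not_dvd hp).mpr hpm)
  have hap : cuspCoeff fE 2 = ((E.frobeniusTrace 2 : ℤ) : ℂ) :=
    cuspCoeff_eq_frobeniusTrace_of_isNewformOf_holds hfE hord.1
  have hχp : (χ.ringHomComp (Int.castRingHom ℚ)) ((2 : ℕ) : ZMod d.natAbs) ^ 2 = 1 := by
    rw [MulChar.ringHomComp_apply, ← map_pow, mulChar_jacobi_apply_natCast_sq hχ 2 hmp.symm, map_one]
  obtain ⟨teich, hc⟩ := exists_teichmuller_frobeniusExponent (p := 2) hmp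
  have key := padicLFunctionMinusBranch_twist_eq_of_birch_even fE fV hfE.1 hfE.coeffField_eq_bot hpN hmp hap hαeq hαu
    (χ.ringHomComp (Int.castRingHom ℚ)) hχp hB hc 1
  rw [mul_assoc] at key
  obtain ⟨c', hc'sq, key'⟩ := exists_eq_C_mul_of_sign (coe_rootsOfUnity_torsionOrder_two_eq_or teich) key
  have hαV' : (unitRoot V 2 : ℚ_[2]) =
      (((χ.ringHomComp (Int.castRingHom ℚ)) ((2 : ℕ) : ZMod d.natAbs) : ℚ) : ℚ_[2]) * (unitRoot E 2 : ℚ_[2]) := by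
    rw [hαV, MulChar.ringHomComp_apply, mulChar_jacobi_apply_natCast hχ 2, eq_intCast]
    push_cast
    rfl
  have hper' := hper (exists_ratMinusSymbol_ne_zero' hfV)
  have hper'' : (c' : ℝ) ^ 2 * (d : ℝ) * minusPeriod fV ^ 2 = minusPeriod fE ^ 2 := by
    rw [show ((c' : ℝ)) ^ 2 = (c : ℝ) ^ 2 by exact_mod_cast hc'sq]
    exact hper'
  refine ⟨hordV, c', ?_, by rw [hαV', key', mul_assoc], hper''⟩
  rintro rfl
  rw [Rat.cast_zero, zero_pow two_ne_zero, zero_mul, zero_mul] at hper''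
  exact (pow_pos (IsNewform0.minusPeriod_pos_holds hfE.1 hfE.coeffField_eq_bot) 2).ne hper''

/-! ### §1′ One Birch constant, sign branch, `d < 0` -/

/-- ★★ **One Birch constant at `p = 2` for the SIGN branch, `d < 0`** (`χ_d` odd of conductor `|d| ≡ 3 (mod 4)`): `V` is good ordinary at
`2`, and ONE `c ∈ ℚˣ` satisfies (i) `L⁻₂(f_V, α_V, ω, T) = C(c)·(1+T)^{−ℓ_m}·L₂(f_E, m, α_E, ωχ_d, T)` (`m = |d|`; the `ω`-branch of the
`χ_d`-twisted PLUS tame transform of `f_E`) and (ii) `c²·|d|·(Ω⁻_{f_V})² = (Ω⁺_{f_E})²`.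
[cite: MazurTateTeitelbaum1986Invent, §I.8 and §I.11–I.13] [cite: Matsuno2000, §2 (p. 84)] -/
theorem exists_birchConstantMinus_two_neg (hmod : exists_isNewformOf) (hd : d < 0) (hd4 : d % 4 = 1) (hsq : Squarefree d)
    (hcop : IsCoprime d (E.conductorNorm ℤ : ℤ)) {C₀ : VariableChange ℚ} (hV : C₀ • E.quadraticTwist (d : ℚ) = V)
    (hfE : IsNewformOf E fE) (hfV : IsNewformOf V fV) (hord : IsOrdinaryAt E 2)
    {χ : MulChar (ZMod d.natAbs) ℤ} (hχ : ∀ a : ZMod d.natAbs, χ a = J((a.val : ℤ) | d.natAbs)) :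
    IsOrdinaryAt V 2 ∧ ∃ c : ℚ, c ≠ 0 ∧
      padicLFunctionMinusBranch fV (unitRoot V 2 : ℚ_[2]) 1 =
        PowerSeries.C (c : ℚ_[2]) * PowerSeries.binomialSeries ℚ_[2] (-frobeniusExponent 2 (d.natAbs : ℤ_[2])) *
          padicLFunctionTameBranch fE d.natAbs (unitRoot E 2 : ℚ_[2])
            ((χ.ringHomComp (Int.castRingHom ℚ)).ringHomComp (Rat.castHom ℚ_[2])) 1 ∧
      (c : ℝ) ^ 2 * (d.natAbs : ℝ) * minusPeriod fV ^ 2 = plusPeriod fE ^ 2 := by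
  have hp : (2 : ℕ).Prime := Nat.prime_two
  have hpd : ¬ ((2 : ℕ) : ℤ) ∣ d := by omega
  obtain ⟨c, hB, hper⟩ := exists_ratMinusSymbol_negTwist_eq_sum_and_sq E hmod hd hd4 hsq hcop hV hfE hfV hχ
  obtain ⟨hordV, hαV⟩ := isOrdinaryAt_twist_and_unitRoot_eq E 2 hmod hd4 hsq hcop hV hord hpd
  obtain ⟨hαeq, hαu, -⟩ := unitRoot_coe_spec (W := E) hord
  have hpN : ¬ 2 ∣ E.conductorNorm ℤ := not_dvd_level_of_isNewformOf hfE hord.1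
  have hpm : ¬ 2 ∣ d.natAbs := fun h ↦ hpd (Int.natCast_dvd.mpr h)
  have hmp : d.natAbs.Coprime 2 := Nat.coprime_comm.mp ((Nat.Prime.coprime_iff_not_dvd hp).mpr hpm)
  have hap : cuspCoeff fE 2 = ((E.frobeniusTrace 2 : ℤ) : ℂ) :=
    cuspCoeff_eq_frobeniusTrace_of_isNewformOf_holds hfE hord.1
  have hχp : (χ.ringHomComp (Int.castRingHom ℚ)) ((2 : ℕ) : ZMod d.natAbs) ^ 2 = 1 := by
    rw [MulChar.ringHomComp_apply, ← map_pow, mulChar_jacobi_apply_natCast_sq hχ 2 hmp.symm, map_one]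
  -- the symbol relation with `χ` read in `ℚ`
  have hB' : ∀ x : ℚ, ratMinusSymbol fV x = c * ∑ b : ZMod d.natAbs,
      (χ.ringHomComp (Int.castRingHom ℚ)) b * ratPlusSymbol fE (x + (b.val : ℚ) / d.natAbs) := by
    intro x
    rw [hB x]
    congr 1
    refine Finset.sum_congr rfl fun b _ ↦ ?_
    rw [MulChar.ringHomComp_apply, hχ, eq_intCast]
  obtain ⟨teich, hc⟩ := exists_teichmuller_frobeniusExponent (p := 2) hmp
  have key := padicLFunctionMinusBranch_twist_eq_of_birch_odd fE fV hfE.1 hfE.coeffField_eq_bot hpN hmp hap hαeq hαu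
    (χ.ringHomComp (Int.castRingHom ℚ)) hχp hB' hc 1
  rw [mul_assoc] at key
  obtain ⟨c', hc'sq, key'⟩ := exists_eq_C_mul_of_sign (coe_rootsOfUnity_torsionOrder_two_eq_or teich) key
  have hαV' : (unitRoot V 2 : ℚ_[2]) =
      (((χ.ringHomComp (Int.castRingHom ℚ)) ((2 : ℕ) : ZMod d.natAbs) : ℚ) : ℚ_[2]) * (unitRoot E 2 : ℚ_[2]) := by
    rw [hαV, MulChar.ringHomComp_apply, mulChar_jacobi_apply_natCast hχ 2, eq_intCast]
    push_cast
    rfl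
  have hper' := hper (exists_ratMinusSymbol_ne_zero' hfV)
  have hper'' : (c' : ℝ) ^ 2 * (d.natAbs : ℝ) * minusPeriod fV ^ 2 = plusPeriod fE ^ 2 := by
    rw [show ((c' : ℝ)) ^ 2 = (c : ℝ) ^ 2 by exact_mod_cast hc'sq]
    exact hper'
  refine ⟨hordV, c', ?_, by rw [hαV', key', mul_assoc], hper''⟩
  rintro rfl
  rw [Rat.cast_zero, zero_pow two_ne_zero, zero_mul, zero_mul] at hper''
  exact (pow_pos (IsNewform0.plusPeriod_pos_holds hfE.1 hfE.coeffField_eq_bot) 2).ne hper''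

/-! ### §2 The `χ₋₄`-type object: the first coefficient transports -/

/-- ★★ **First coefficient of the sign branch transports, `d > 0`.** In the setting of `exists_birchConstantMinus_two`, if
`L⁻₂(f_V, α_V, ω; 0) = 0` (the sign-forced zero of the `χ₋₄`-class), then the tame branch `G` also vanishes at `T = 0`,
`[T¹]L⁻₂(f_V, α_V, ω) = c·[T¹]G`, the two are non-zero simultaneously, and `v₂([T¹]L⁻₂) = v₂(c) + v₂([T¹]G)` — for the SAME `c` as in
`c²·d·(Ω⁻_{f_V})² = (Ω⁻_{f_E})²`. [cite: MazurTateTeitelbaum1986Invent, §I.8 and §I.13] -/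
theorem coeff_one_padicLFunctionMinusBranch_twist_eq (hmod : exists_isNewformOf) (hd : 0 < d) (hd4 : d % 4 = 1)
    (hsq : Squarefree d) (hcop : IsCoprime d (E.conductorNorm ℤ : ℤ)) {C₀ : VariableChange ℚ}
    (hV : C₀ • E.quadraticTwist (d : ℚ) = V) (hfE : IsNewformOf E fE) (hfV : IsNewformOf V fV)
    (hord : IsOrdinaryAt E 2) {χ : MulChar (ZMod d.natAbs) ℤ}
    (hχ : ∀ a : ZMod d.natAbs, χ a = J((a.val : ℤ) | d.natAbs))
    (h0 : PowerSeries.constantCoeff (padicLFunctionMinusBranch fV (unitRoot V 2 : ℚ_[2]) 1) = 0) :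
    ∃ c : ℚ, c ≠ 0 ∧ (c : ℝ) ^ 2 * (d : ℝ) * minusPeriod fV ^ 2 = minusPeriod fE ^ 2 ∧
      PowerSeries.constantCoeff (padicLFunctionTameMinusBranch fE d.natAbs (unitRoot E 2 : ℚ_[2])
        ((χ.ringHomComp (Int.castRingHom ℚ)).ringHomComp (Rat.castHom ℚ_[2])) 1) = 0 ∧
      PowerSeries.coeff 1 (padicLFunctionMinusBranch fV (unitRoot V 2 : ℚ_[2]) 1) =
        (c : ℚ_[2]) * PowerSeries.coeff 1 (padicLFunctionTameMinusBranch fE d.natAbs (unitRoot E 2 : ℚ_[2])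
          ((χ.ringHomComp (Int.castRingHom ℚ)).ringHomComp (Rat.castHom ℚ_[2])) 1) ∧
      (PowerSeries.coeff 1 (padicLFunctionMinusBranch fV (unitRoot V 2 : ℚ_[2]) 1) ≠ 0 ↔
        PowerSeries.coeff 1 (padicLFunctionTameMinusBranch fE d.natAbs (unitRoot E 2 : ℚ_[2])
          ((χ.ringHomComp (Int.castRingHom ℚ)).ringHomComp (Rat.castHom ℚ_[2])) 1) ≠ 0) ∧
      (PowerSeries.coeff 1 (padicLFunctionTameMinusBranch fE d.natAbs (unitRoot E 2 : ℚ_[2])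
          ((χ.ringHomComp (Int.castRingHom ℚ)).ringHomComp (Rat.castHom ℚ_[2])) 1) ≠ 0 →
        (PowerSeries.coeff 1 (padicLFunctionMinusBranch fV (unitRoot V 2 : ℚ_[2]) 1)).valuation =
          padicValRat 2 c + (PowerSeries.coeff 1 (padicLFunctionTameMinusBranch fE d.natAbs (unitRoot E 2 : ℚ_[2])
            ((χ.ringHomComp (Int.castRingHom ℚ)).ringHomComp (Rat.castHom ℚ_[2])) 1)).valuation) := by
  obtain ⟨-, c, hc0, hkey, hper⟩ := exists_birchConstantMinus_two E hmod hd hd4 hsq hcop hV hfE hfV hord hχ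
  have hc0' : (c : ℚ_[2]) ≠ 0 := by exact_mod_cast hc0
  obtain ⟨hG0, h1⟩ := coeff_one_eq_of_eq_C_mul_binomialSeries_mul hc0' _ hkey h0
  refine ⟨c, hc0, hper, hG0, h1, ?_, fun hG ↦ ?_⟩
  · rw [h1]
    exact ⟨fun h hG ↦ h (by rw [hG, mul_zero]), fun hG ↦ mul_ne_zero hc0' hG⟩
  · rw [h1, Padic.valuation_mul hc0' hG, Padic.valuation_ratCast]

/-- ★★ **First coefficient of the sign branch transports, `d < 0`** (PLUS tame branch `G` of `f_E`; period identity
`c²·|d|·(Ω⁻_{f_V})² = (Ω⁺_{f_E})²`). [cite: MazurTateTeitelbaum1986Invent, §I.8 and §I.13] -/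
theorem coeff_one_padicLFunctionMinusBranch_negTwist_eq (hmod : exists_isNewformOf) (hd : d < 0) (hd4 : d % 4 = 1)
    (hsq : Squarefree d) (hcop : IsCoprime d (E.conductorNorm ℤ : ℤ)) {C₀ : VariableChange ℚ}
    (hV : C₀ • E.quadraticTwist (d : ℚ) = V) (hfE : IsNewformOf E fE) (hfV : IsNewformOf V fV)
    (hord : IsOrdinaryAt E 2) {χ : MulChar (ZMod d.natAbs) ℤ}
    (hχ : ∀ a : ZMod d.natAbs, χ a = J((a.val : ℤ) | d.natAbs))
    (h0 : PowerSeries.constantCoeff (padicLFunctionMinusBranch fV (unitRoot V 2 : ℚ_[2]) 1) = 0) :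
    ∃ c : ℚ, c ≠ 0 ∧ (c : ℝ) ^ 2 * (d.natAbs : ℝ) * minusPeriod fV ^ 2 = plusPeriod fE ^ 2 ∧
      PowerSeries.constantCoeff (padicLFunctionTameBranch fE d.natAbs (unitRoot E 2 : ℚ_[2])
        ((χ.ringHomComp (Int.castRingHom ℚ)).ringHomComp (Rat.castHom ℚ_[2])) 1) = 0 ∧
      PowerSeries.coeff 1 (padicLFunctionMinusBranch fV (unitRoot V 2 : ℚ_[2]) 1) =
        (c : ℚ_[2]) * PowerSeries.coeff 1 (padicLFunctionTameBranch fE d.natAbs (unitRoot E 2 : ℚ_[2])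
          ((χ.ringHomComp (Int.castRingHom ℚ)).ringHomComp (Rat.castHom ℚ_[2])) 1) ∧
      (PowerSeries.coeff 1 (padicLFunctionMinusBranch fV (unitRoot V 2 : ℚ_[2]) 1) ≠ 0 ↔
        PowerSeries.coeff 1 (padicLFunctionTameBranch fE d.natAbs (unitRoot E 2 : ℚ_[2])
          ((χ.ringHomComp (Int.castRingHom ℚ)).ringHomComp (Rat.castHom ℚ_[2])) 1) ≠ 0) ∧
      (PowerSeries.coeff 1 (padicLFunctionTameBranch fE d.natAbs (unitRoot E 2 : ℚ_[2])
          ((χ.ringHomComp (Int.castRingHom ℚ)).ringHomComp (Rat.castHom ℚ_[2])) 1) ≠ 0 →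
        (PowerSeries.coeff 1 (padicLFunctionMinusBranch fV (unitRoot V 2 : ℚ_[2]) 1)).valuation =
          padicValRat 2 c + (PowerSeries.coeff 1 (padicLFunctionTameBranch fE d.natAbs (unitRoot E 2 : ℚ_[2])
            ((χ.ringHomComp (Int.castRingHom ℚ)).ringHomComp (Rat.castHom ℚ_[2])) 1)).valuation) := by
  obtain ⟨-, c, hc0, hkey, hper⟩ := exists_birchConstantMinus_two_neg E hmod hd hd4 hsq hcop hV hfE hfV hord hχ
  have hc0' : (c : ℚ_[2]) ≠ 0 := by exact_mod_cast hc0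
  obtain ⟨hG0, h1⟩ := coeff_one_eq_of_eq_C_mul_binomialSeries_mul hc0' _ hkey h0
  refine ⟨c, hc0, hper, hG0, h1, ?_, fun hG ↦ ?_⟩
  · rw [h1]
    exact ⟨fun h hG ↦ h (by rw [hG, mul_zero]), fun hG ↦ mul_ne_zero hc0' hG⟩
  · rw [h1, Padic.valuation_mul hc0' hG, Padic.valuation_ratCast]

/-! ### §3 The `χ₋₈`-type object: the derivative at the conductor-`8` point transports -/

/-- **Derivative transport through a Birch identity at a zero at `T = −2`** (abstract form of `deriv_padicLFunction_twist_eq`): if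
`L = C(c)·(1+T)^{−s}·G` in `ℚ₂⟦T⟧` with `c ≠ 0`, `L` has bounded coefficients and `Σ_k [T^k]L·(−2)^k = 0`, then `G` vanishes at `−2` too
and `Σ_k k[T^k]L(−2)^{k−1} = c·u·Σ_k k[T^k]G(−2)^{k−1}` with `u = ev_{−2}(1+T)^{−s}`, `‖u‖₂ = 1` (product rule at a zero,
`PadicEval.tsum_deriv_mul_of_eval_eq_zero`). [cite: MazurTateTeitelbaum1986Invent, §I.12–I.13] -/
theorem tsum_deriv_eq_of_eq_C_mul_binomialSeries_mul {L G : PowerSeries ℚ_[2]} {c : ℚ_[2]} (hc : c ≠ 0) (s : ℤ_[2])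
    (hL : L = PowerSeries.C c * PowerSeries.binomialSeries ℚ_[2] (-s) * G) {B : ℝ} (hB : ∀ k, ‖PowerSeries.coeff k L‖ ≤ B)
    (h0 : HasSum (fun k : ℕ ↦ PowerSeries.coeff k L * (-2 : ℚ_[2]) ^ k) 0) :
    HasSum (fun k : ℕ ↦ PowerSeries.coeff k G * (-2 : ℚ_[2]) ^ k) 0 ∧
      ∃ u : ℚ_[2], ‖u‖ = 1 ∧
        (∑' k : ℕ, PowerSeries.coeff k L * (k : ℚ_[2]) * (-2) ^ (k - 1)) =
          c * u * ∑' k : ℕ, PowerSeries.coeff k G * (k : ℚ_[2]) * (-2) ^ (k - 1) := by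
  set P := PowerSeries.binomialSeries ℚ_[2] (-s) with hPdef
  have hBP : ∀ k, ‖PowerSeries.coeff k P‖ ≤ 1 := norm_coeff_binomialSeries_le_one (-s)
  obtain ⟨BG, hBG⟩ := exists_norm_coeff_le_of_eq_C_mul_binomialSeries_mul hc s hL hB
  have ha := norm_neg_two_lt_one₃
  have hevL : ∑' k : ℕ, PowerSeries.coeff k L * (-2 : ℚ_[2]) ^ k = 0 := h0.tsum_eq
  have hevPG : ∑' k : ℕ, PowerSeries.coeff k L * (-2 : ℚ_[2]) ^ k =
      c * ((∑' k : ℕ, PowerSeries.coeff k P * (-2 : ℚ_[2]) ^ k) *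
        ∑' k : ℕ, PowerSeries.coeff k G * (-2 : ℚ_[2]) ^ k) := by
    rw [hL, mul_assoc, tsum_eval_C_mul, tsum_coeff_mul hBP hBG ha]
  have hu : ‖∑' k : ℕ, PowerSeries.coeff k P * (-2 : ℚ_[2]) ^ k‖ = 1 := norm_tsum_eval_binomialSeries (-s) ha
  have hP0 : ∑' k : ℕ, PowerSeries.coeff k P * (-2 : ℚ_[2]) ^ k ≠ 0 := tsum_eval_binomialSeries_ne_zero (-s) ha
  have hevG : ∑' k : ℕ, PowerSeries.coeff k G * (-2 : ℚ_[2]) ^ k = 0 := by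
    rw [hevL] at hevPG
    rcases mul_eq_zero.mp hevPG.symm with h | h
    · exact absurd h hc
    · rcases mul_eq_zero.mp h with h' | h'
      · exact absurd h' hP0
      · exact h'
  have hGsum : HasSum (fun k : ℕ ↦ PowerSeries.coeff k G * (-2 : ℚ_[2]) ^ k) 0 := by
    rw [← hevG]; exact (summable_of_norm_le hBG ha).hasSum
  have hD : ∑' k : ℕ, PowerSeries.coeff k L * (k : ℚ_[2]) * (-2) ^ (k - 1) =
      c * (∑' k : ℕ, PowerSeries.coeff k P * (-2 : ℚ_[2]) ^ k) *
        ∑' k : ℕ, PowerSeries.coeff k G * (k : ℚ_[2]) * (-2) ^ (k - 1) := by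
    rw [hL, mul_assoc, tsum_deriv_C_mul, tsum_deriv_mul_of_eval_eq_zero hBP hBG ha hevG, mul_assoc]
  exact ⟨hGsum, _, hu, hD⟩

/-- ★★ **The derivative of the sign branch at the conductor-`8` point transports, `d > 0`.** In the setting of
`exists_birchConstantMinus_two`, if `Σ_k [T^k]L⁻₂(f_V, α_V, ω)·(−2)^k = 0` (the sign-forced zero of the `χ₋₈`-class), then the tame branch
`G = L⁻₂(f_E, m, α_E, ωχ_d, ·)` also vanishes at `−2`, `D_V = c·u·D_G` with `‖u‖₂ = 1`, hence `D_V ≠ 0 ↔ D_G ≠ 0` and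
`v₂(D_V) = v₂(c) + v₂(D_G)` — for the SAME `c` as in `c²·d·(Ω⁻_{f_V})² = (Ω⁻_{f_E})²`.
[cite: MazurTateTeitelbaum1986Invent, §I.8 and §I.13] [cite: Matsuno2000, §2 (p. 84)] -/
theorem valuation_deriv_padicLFunctionMinusBranch_twist_eq (hmod : exists_isNewformOf) (hd : 0 < d) (hd4 : d % 4 = 1)
    (hsq : Squarefree d) (hcop : IsCoprime d (E.conductorNorm ℤ : ℤ)) {C₀ : VariableChange ℚ}
    (hV : C₀ • E.quadraticTwist (d : ℚ) = V) (hfE : IsNewformOf E fE) (hfV : IsNewformOf V fV)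
    (hord : IsOrdinaryAt E 2) {χ : MulChar (ZMod d.natAbs) ℤ}
    (hχ : ∀ a : ZMod d.natAbs, χ a = J((a.val : ℤ) | d.natAbs))
    (h0 : HasSum (fun k : ℕ ↦ PowerSeries.coeff k (padicLFunctionMinusBranch fV (unitRoot V 2 : ℚ_[2]) 1) *
      (-2 : ℚ_[2]) ^ k) 0) :
    ∃ c : ℚ, c ≠ 0 ∧ (c : ℝ) ^ 2 * (d : ℝ) * minusPeriod fV ^ 2 = minusPeriod fE ^ 2 ∧
      HasSum (fun k : ℕ ↦ PowerSeries.coeff k (padicLFunctionTameMinusBranch fE d.natAbs (unitRoot E 2 : ℚ_[2])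
        ((χ.ringHomComp (Int.castRingHom ℚ)).ringHomComp (Rat.castHom ℚ_[2])) 1) * (-2 : ℚ_[2]) ^ k) 0 ∧
      ((∑' k : ℕ, PowerSeries.coeff k (padicLFunctionMinusBranch fV (unitRoot V 2 : ℚ_[2]) 1) * (k : ℚ_[2]) *
            (-2) ^ (k - 1)) ≠ 0 ↔
        (∑' k : ℕ, PowerSeries.coeff k (padicLFunctionTameMinusBranch fE d.natAbs (unitRoot E 2 : ℚ_[2])
            ((χ.ringHomComp (Int.castRingHom ℚ)).ringHomComp (Rat.castHom ℚ_[2])) 1) * (k : ℚ_[2]) *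
              (-2) ^ (k - 1)) ≠ 0) ∧
      ((∑' k : ℕ, PowerSeries.coeff k (padicLFunctionTameMinusBranch fE d.natAbs (unitRoot E 2 : ℚ_[2])
            ((χ.ringHomComp (Int.castRingHom ℚ)).ringHomComp (Rat.castHom ℚ_[2])) 1) * (k : ℚ_[2]) *
              (-2) ^ (k - 1)) ≠ 0 →
        (∑' k : ℕ, PowerSeries.coeff k (padicLFunctionMinusBranch fV (unitRoot V 2 : ℚ_[2]) 1) * (k : ℚ_[2]) *
            (-2) ^ (k - 1)).valuation =
          padicValRat 2 c + (∑' k : ℕ, PowerSeries.coeff k (padicLFunctionTameMinusBranch fE d.natAbs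
            (unitRoot E 2 : ℚ_[2]) ((χ.ringHomComp (Int.castRingHom ℚ)).ringHomComp (Rat.castHom ℚ_[2])) 1) *
              (k : ℚ_[2]) * (-2) ^ (k - 1)).valuation) := by
  obtain ⟨hordV, c, hc0, hkey, hper⟩ := exists_birchConstantMinus_two E hmod hd hd4 hsq hcop hV hfE hfV hord hχ
  have hc0' : (c : ℚ_[2]) ≠ 0 := by exact_mod_cast hc0
  obtain ⟨BL, hBL⟩ := exists_norm_coeff_padicLFunctionMinusBranch_le (V := V) hordV hfV 1
  obtain ⟨hGsum, u, hu, hD⟩ := tsum_deriv_eq_of_eq_C_mul_binomialSeries_mul hc0' _ hkey hBL h0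
  have hu0 : u ≠ 0 := norm_pos_iff.mp (by rw [hu]; exact one_pos)
  have hvu : u.valuation = 0 := valuation_eq_of_norm_eq hu0 (n := 0) (by rw [hu]; simp)
  refine ⟨c, hc0, hper, hGsum, ?_, fun hG ↦ ?_⟩
  · rw [hD]
    refine ⟨fun h hG ↦ h (by rw [hG, mul_zero]), fun hG ↦ mul_ne_zero (mul_ne_zero hc0' hu0) hG⟩
  · rw [hD, Padic.valuation_mul (mul_ne_zero hc0' hu0) hG, Padic.valuation_mul hc0' hu0, Padic.valuation_ratCast,
      hvu, add_zero]

/-- ★★ **The derivative of the sign branch at the conductor-`8` point transports, `d < 0`** (PLUS tame branch `G` of `f_E`; period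
identity `c²·|d|·(Ω⁻_{f_V})² = (Ω⁺_{f_E})²`). [cite: MazurTateTeitelbaum1986Invent, §I.8 and §I.13] [cite: Matsuno2000, §2 (p. 84)] -/
theorem valuation_deriv_padicLFunctionMinusBranch_negTwist_eq (hmod : exists_isNewformOf) (hd : d < 0) (hd4 : d % 4 = 1)
    (hsq : Squarefree d) (hcop : IsCoprime d (E.conductorNorm ℤ : ℤ)) {C₀ : VariableChange ℚ}
    (hV : C₀ • E.quadraticTwist (d : ℚ) = V) (hfE : IsNewformOf E fE) (hfV : IsNewformOf V fV)
    (hord : IsOrdinaryAt E 2) {χ : MulChar (ZMod d.natAbs) ℤ}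
    (hχ : ∀ a : ZMod d.natAbs, χ a = J((a.val : ℤ) | d.natAbs))
    (h0 : HasSum (fun k : ℕ ↦ PowerSeries.coeff k (padicLFunctionMinusBranch fV (unitRoot V 2 : ℚ_[2]) 1) *
      (-2 : ℚ_[2]) ^ k) 0) :
    ∃ c : ℚ, c ≠ 0 ∧ (c : ℝ) ^ 2 * (d.natAbs : ℝ) * minusPeriod fV ^ 2 = plusPeriod fE ^ 2 ∧
      HasSum (fun k : ℕ ↦ PowerSeries.coeff k (padicLFunctionTameBranch fE d.natAbs (unitRoot E 2 : ℚ_[2])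
        ((χ.ringHomComp (Int.castRingHom ℚ)).ringHomComp (Rat.castHom ℚ_[2])) 1) * (-2 : ℚ_[2]) ^ k) 0 ∧
      ((∑' k : ℕ, PowerSeries.coeff k (padicLFunctionMinusBranch fV (unitRoot V 2 : ℚ_[2]) 1) * (k : ℚ_[2]) *
            (-2) ^ (k - 1)) ≠ 0 ↔
        (∑' k : ℕ, PowerSeries.coeff k (padicLFunctionTameBranch fE d.natAbs (unitRoot E 2 : ℚ_[2])
            ((χ.ringHomComp (Int.castRingHom ℚ)).ringHomComp (Rat.castHom ℚ_[2])) 1) * (k : ℚ_[2]) *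
              (-2) ^ (k - 1)) ≠ 0) ∧
      ((∑' k : ℕ, PowerSeries.coeff k (padicLFunctionTameBranch fE d.natAbs (unitRoot E 2 : ℚ_[2])
            ((χ.ringHomComp (Int.castRingHom ℚ)).ringHomComp (Rat.castHom ℚ_[2])) 1) * (k : ℚ_[2]) *
              (-2) ^ (k - 1)) ≠ 0 →
        (∑' k : ℕ, PowerSeries.coeff k (padicLFunctionMinusBranch fV (unitRoot V 2 : ℚ_[2]) 1) * (k : ℚ_[2]) *
            (-2) ^ (k - 1)).valuation =
          padicValRat 2 c + (∑' k : ℕ, PowerSeries.coeff k (padicLFunctionTameBranch fE d.natAbs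
            (unitRoot E 2 : ℚ_[2]) ((χ.ringHomComp (Int.castRingHom ℚ)).ringHomComp (Rat.castHom ℚ_[2])) 1) *
              (k : ℚ_[2]) * (-2) ^ (k - 1)).valuation) := by
  obtain ⟨hordV, c, hc0, hkey, hper⟩ := exists_birchConstantMinus_two_neg E hmod hd hd4 hsq hcop hV hfE hfV hord hχ
  have hc0' : (c : ℚ_[2]) ≠ 0 := by exact_mod_cast hc0
  obtain ⟨BL, hBL⟩ := exists_norm_coeff_padicLFunctionMinusBranch_le (V := V) hordV hfV 1
  obtain ⟨hGsum, u, hu, hD⟩ := tsum_deriv_eq_of_eq_C_mul_binomialSeries_mul hc0' _ hkey hBL h0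
  have hu0 : u ≠ 0 := norm_pos_iff.mp (by rw [hu]; exact one_pos)
  have hvu : u.valuation = 0 := valuation_eq_of_norm_eq hu0 (n := 0) (by rw [hu]; simp)
  refine ⟨c, hc0, hper, hGsum, ?_, fun hG ↦ ?_⟩
  · rw [hD]
    refine ⟨fun h hG ↦ h (by rw [hG, mul_zero]), fun hG ↦ mul_ne_zero (mul_ne_zero hc0' hu0) hG⟩
  · rw [hD, Padic.valuation_mul (mul_ne_zero hc0' hu0) hG, Padic.valuation_mul hc0' hu0, Padic.valuation_ratCast,
      hvu, add_zero]

end Transport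

end Summit.BirchSwinnertonDyer.BirchSwinnertonDyer.Theorems.PrintCf2.DisegniPairTwo

end
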